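import Literature.MathematicalPhysics.QuantumFieldTheory.ConformalBootstrap3D.PointKernelK34v2Data

/-!
# K34v2 certificate, kernel block file H7: head segments `78 ≤ i < 116` (block-checked ones)

`decide` by kernel reduction (no `native_decide`, no extra axioms) of the block checker
`PCert.hBlockOK` of `PointKernel` on the literal data of `PointKernelK34v2Data` (cells checked corner
or chord by the rule bit); soundness is `PCert.hBlockOK_sound`.  Estimated kernel time 259 s
(5 theorems).
-/

set_option maxRecDepth 100000
set_option maxHeartbeats 0

namespace Literature.MathematicalPhysics.QuantumFieldTheory.ConformalBootstrap3D.PointKernelK34v2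

open Literature.MathematicalPhysics.QuantumFieldTheory.ConformalBootstrap3D.PointKernel

/-- head segments `[78, 80)` pass the kernel evaluator (≈58 s of kernel work). [folklore] -/
theorem hBlock_78 : certK34v2.hBlockOK hsegsK34v2 78 80 JHK34v2 = true := by
  decide +kernel

/-- head segments `[80, 97)` pass the kernel evaluator (≈38 s of kernel work). [folklore] -/
theorem hBlock_80 : certK34v2.hBlockOK hsegsK34v2 80 97 JHK34v2 = true := by
  decide +kernel

/-- head segment `[113, 114)` passes the kernel evaluator (≈30 s of kernel work). [folklore] -/
theorem hBlock_113 : certK34v2.hBlockOK hsegsK34v2 113 114 JHK34v2 = true := by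
  decide +kernel

/-- head segment `[114, 115)` passes the kernel evaluator (≈41 s of kernel work). [folklore] -/
theorem hBlock_114 : certK34v2.hBlockOK hsegsK34v2 114 115 JHK34v2 = true := by
  decide +kernel

/-- head segment `[115, 116)` passes the kernel evaluator (≈41 s of kernel work). [folklore] -/
theorem hBlock_115 : certK34v2.hBlockOK hsegsK34v2 115 116 JHK34v2 = true := by
  decide +kernel

end Literature.MathematicalPhysics.QuantumFieldTheory.ConformalBootstrap3D.PointKernelK34v2
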